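import Mathlib.Analysis.Complex.Basic
import Literature.Probability.LatticeModels.TriangularLatticeProofs
import Literature.Probability.Percolation.TriLoopWinding

-- STATUS (line bridge-gate-renewal, stub 5 `stub_carvedToSLE`, 2026-08-16): rc 0, 0 sorries, 0 warnings.
-- Discharges the hypothesis `hlat` of `mem_carvedVerts_iff_of_window`
-- (`…ObservableToSLERCarvedDictionary.lean`) in the orientation `k = 0` (`rowOf 0 v = v.1 1`).

/-!
# Carved-domain dictionary for the stub `stub_carvedToSLE`: honeycomb half-balls above a zigzag row
are connected (orientation `k = 0`)

Landing target:
`Summits/CriticalPhenomena/SAWScalingLimit/Theorems/SAWDefectDecoherenceObservableToSLERCarvedDictionaryHalfBall.lean`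
(`--supports stmt-CriticalPhenomena-14005`, registered sub-goal `stub_carvedToSLE_halfBallRowZero`).

The exact half-lattice clause of `R6` for the carved vertex set inside a clean window
(`mem_carvedVerts_iff_of_window` of `…ObservableToSLERCarvedDictionary.lean`, registered sub-goal
`stub_carvedToSLE_windowClause`) was proved up to a statement about the honeycomb lattice alone,
its hypothesis `hlat`: every vertex `v` of the window region beyond the gate row is joined to the
new root `q` by a honeycomb walk through window vertices beyond the gate row.  This file proves it
in the untilted orientation `k = 0` (`rowOf 0 v = v.1 1`, the class of `HexObservableLimitR`
itself), where the gate is a vertical edge `{p, q} = {(x - e₁, 1), (x, 0)}`, the new root is the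
up-face `q = (x, 0)` and "beyond the gate row" is `x 1 ≤ v.1 1`, with NO loss of radius:

* `exists_adj_energy_lt` — DESCENT: every vertex `v ≠ q` with `x 1 ≤ v.1 1` has a honeycomb
  neighbour `v'` with `x 1 ≤ v'.1 1` strictly closer to `c_q`, distance being measured by the
  integer `halfBallEnergy x v = 12 |c_v - c_q|²` (`twelve_mul_dist_sq_eq`);
* `exists_walk_energy_le` — hence a honeycomb walk from `v` to `q` through vertices beyond the
  gate row, all at distance `≤ |c_v - c_q|` from `c_q`;
* `exists_walk_halfBall_rowZero` — the `hlat`-shaped statement: for `δ c_v ∈ B(δ c_q, ρ)` with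
  `x 1 ≤ v.1 1` there is a honeycomb walk from `q` to `v` all of whose vertices `y` satisfy
  `δ c_y ∈ B(δ c_q, ρ)` and `x 1 ≤ y.1 1` (any real `δ`, `ρ`); registry form
  `stub_carvedToSLE_halfBallRowZero`.

In orientation `0` every gate `{p, q}` with `rowOf 0 q = rowOf 0 p + 1` has an up-face `q = (x, 0)`
as its new root and `p = (x - e₁, 1)` (`gate_rowZero_eq`, `gate_rowZero_ne_down`), so the above
covers all gates of that class; the five other orientations follow by the lattice symmetries of
the line's orientation API (not here).  Coordinates: `re c_{(y,t)} = y₀ + y₁/2 + (t+1)/2`, `im c_{(y,t)} = (y₁ + (t+1)/3) √3/2`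
(`hexCenter_re`, `hexCenter_im` of `TriLoopWinding.lean`); adjacency of up and down faces:
`hexGraph_adj_iff_of_snd_eq_zero_holds`, `hexGraph_adj_iff_of_snd_eq_one`
(`TriangularLatticeProofs.lean`).
-/

noncomputable section

open Literature.Probability.LatticeModels (HexVertex hexGraph hexCenter Site
  hexGraph_adj_iff_of_snd_eq_zero_holds hexGraph_adj_iff_of_snd_eq_one)
open Literature.Probability.Percolation (hexCenter_re hexCenter_im)

namespace Summit.CriticalPhenomena.SAWScalingLimit.Theorems.ObservableToSLER.BridgeGate

/-! ### The integer distance to the new root -/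

/-- `12 |c_v - c_q|²` for the up-face root `q = (x, 0)`, as an integer: with
`2 re (c_v - c_q) = 2 (v₀ - x₀) + (v₁ - x₁) + t` and `2√3 im (c_v - c_q) = 3 (v₁ - x₁) + t`
(`v = (v.1, t)`) it is `3 (2Δ₀ + Δ₁ + t)² + (3Δ₁ + t)²`. -/
def halfBallEnergy (x : Site 2) (v : HexVertex) : ℤ :=
  3 * (2 * (v.1 0 - x 0) + (v.1 1 - x 1) + (v.2 : ℕ)) ^ 2 + (3 * (v.1 1 - x 1) + (v.2 : ℕ)) ^ 2

/-- The energy is nonnegative. -/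
theorem halfBallEnergy_nonneg (x : Site 2) (v : HexVertex) : 0 ≤ halfBallEnergy x v := by
  unfold halfBallEnergy
  positivity

/-- **`12 |c_v - c_q|² = halfBallEnergy x v`.** -/
theorem twelve_mul_dist_sq_eq (x : Site 2) (v : HexVertex) :
    12 * dist (hexCenter v) (hexCenter (x, 0)) ^ 2 = (halfBallEnergy x v : ℝ) := by
  obtain ⟨y, t⟩ := v
  have h3 : Real.sqrt 3 * Real.sqrt 3 = 3 := Real.mul_self_sqrt (by norm_num)
  rw [Complex.dist_eq, Complex.sq_norm, Complex.normSq_apply, Complex.sub_re, Complex.sub_im,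
    hexCenter_re, hexCenter_re, hexCenter_im, hexCenter_im]
  simp only [halfBallEnergy, Fin.val_zero, Nat.cast_zero, Int.cast_add, Int.cast_mul,
    Int.cast_pow, Int.cast_sub, Int.cast_ofNat, Int.cast_natCast]
  nlinarith [h3]

/-- Zero energy means `v = q`. -/
theorem eq_of_halfBallEnergy_eq_zero {x : Site 2} {v : HexVertex} (h : halfBallEnergy x v = 0) :
    v = (x, 0) := by
  obtain ⟨y, t⟩ := v
  unfold halfBallEnergy at h
  have ht : ((t : ℕ) : ℤ) = 0 ∨ ((t : ℕ) : ℤ) = 1 := by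
    fin_cases t <;> simp
  have h1 : 2 * (y 0 - x 0) + (y 1 - x 1) + (t : ℕ) = 0 := by nlinarith
  have h2 : 3 * (y 1 - x 1) + (t : ℕ) = 0 := by nlinarith
  have ht0 : ((t : ℕ) : ℤ) = 0 := by omega
  have hy1 : y 1 = x 1 := by omega
  have hy0 : y 0 = x 0 := by omega
  have ht' : t = 0 := by
    fin_cases t
    · rfl
    · simp at ht0
  subst ht'
  congr 1
  ext i
  fin_cases i
  · exact hy0
  · exact hy1

/-! ### Descent -/

/-- **DESCENT.**  Every honeycomb vertex `v ≠ q = (x, 0)` on or beyond the row of `q`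
(`x 1 ≤ v.1 1`) has a honeycomb neighbour on or beyond that row which is strictly closer to `c_q`:
a down-face steps down-left or down-right, an up-face above the row steps straight down, an up-face
on the row steps sideways-up towards `q`. -/
theorem exists_adj_energy_lt (x : Site 2) (v : HexVertex) (hrow : x 1 ≤ v.1 1) (hne : v ≠ (x, 0)) :
    ∃ v' : HexVertex, hexGraph.Adj v v' ∧ x 1 ≤ v'.1 1 ∧ halfBallEnergy x v' < halfBallEnergy x v := by
  obtain ⟨y, t⟩ := v
  simp only at hrow
  have a0 : (y + Pi.single 0 1 : Site 2) 0 = y 0 + 1 ∧ (y + Pi.single 0 1 : Site 2) 1 = y 1 := by simp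
  have s0 : (y - Pi.single 0 1 : Site 2) 0 = y 0 - 1 ∧ (y - Pi.single 0 1 : Site 2) 1 = y 1 := by simp
  have s1 : (y - Pi.single 1 1 : Site 2) 0 = y 0 ∧ (y - Pi.single 1 1 : Site 2) 1 = y 1 - 1 := by simp
  fin_cases t
  · -- up-face `(y, 0)`
    by_cases hy1 : x 1 < y 1
    · -- step straight down to `(y - e₁, 1)`
      refine ⟨(y - Pi.single 1 1, 1), (hexGraph_adj_iff_of_snd_eq_zero_holds y _).2
        (Or.inr (Or.inr rfl)), by show x 1 ≤ (y - Pi.single 1 1 : Site 2) 1; rw [s1.2]; omega, ?_⟩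
      simp only [halfBallEnergy, Nat.cast_zero, Fin.val_one, Nat.cast_one, s1.1, s1.2]
      nlinarith
    · have hy1' : y 1 = x 1 := le_antisymm (not_lt.1 hy1) hrow
      have hy0 : y 0 ≠ x 0 := by
        intro h0
        apply hne
        simp only [Fin.zero_eta, Prod.mk.injEq, and_true]
        ext i
        fin_cases i
        · exact h0
        · exact hy1'
      rcases lt_or_gt_of_ne hy0 with hlt | hgt
      · -- `q` is to the right: step up-right to `(y, 1)`
        refine ⟨(y, 1), (hexGraph_adj_iff_of_snd_eq_zero_holds y y).2 (Or.inl rfl),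
          by simp only; omega, ?_⟩
        simp only [halfBallEnergy, Nat.cast_zero, Fin.val_one, Nat.cast_one]
        nlinarith
      · -- `q` is to the left: step up-left to `(y - e₀, 1)`
        refine ⟨(y - Pi.single 0 1, 1), (hexGraph_adj_iff_of_snd_eq_zero_holds y _).2
          (Or.inr (Or.inl rfl)), by show x 1 ≤ (y - Pi.single 0 1 : Site 2) 1; rw [s0.2]; omega, ?_⟩
        simp only [halfBallEnergy, Nat.cast_zero, Fin.val_one, Nat.cast_one, s0.1, s0.2]
        nlinarith
  · -- down-face `(y, 1)`: step down-left to `(y, 0)` or down-right to `(y + e₀, 0)`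
    by_cases ha : 0 ≤ 2 * (y 0 - x 0) + (y 1 - x 1) + 1
    · refine ⟨(y, 0), (hexGraph_adj_iff_of_snd_eq_one y y).2 (Or.inl rfl), by simp only; omega, ?_⟩
      simp only [halfBallEnergy, Fin.val_zero, Nat.cast_zero, Nat.cast_one]
      rcases (lt_or_eq_of_le hrow) with hb | hb
      · nlinarith
      · have ha' : 1 ≤ 2 * (y 0 - x 0) + (y 1 - x 1) + 1 := by omega
        nlinarith
    · refine ⟨(y + Pi.single 0 1, 0), (hexGraph_adj_iff_of_snd_eq_one y _).2
        (Or.inr (Or.inl rfl)), by show x 1 ≤ (y + Pi.single 0 1 : Site 2) 1; rw [a0.2]; omega, ?_⟩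
      simp only [halfBallEnergy, Fin.val_zero, Nat.cast_zero, Nat.cast_one, a0.1, a0.2]
      nlinarith

/-! ### The walk -/

/-- **Half-balls above a zigzag row are connected, quantitative form.**  Every honeycomb vertex
`v` on or beyond the row of the up-face `q = (x, 0)` is joined to `q` by a honeycomb walk all of
whose vertices are on or beyond that row and at distance `≤ |c_v - c_q|` from `c_q` (induction on
the energy along the descent). -/
theorem exists_walk_energy_le (x : Site 2) :
    ∀ (n : ℕ) (v : HexVertex), halfBallEnergy x v ≤ n → x 1 ≤ v.1 1 →
      ∃ w : hexGraph.Walk v (x, 0), ∀ y ∈ w.support,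
        x 1 ≤ y.1 1 ∧ halfBallEnergy x y ≤ halfBallEnergy x v := by
  intro n
  induction n with
  | zero =>
    intro v hv hrow
    have h0 : halfBallEnergy x v = 0 := le_antisymm (by exact_mod_cast hv) (halfBallEnergy_nonneg x v)
    obtain rfl := eq_of_halfBallEnergy_eq_zero h0
    exact ⟨SimpleGraph.Walk.nil, fun y hy => by
      rw [SimpleGraph.Walk.support_nil, List.mem_singleton] at hy; subst hy; exact ⟨hrow, le_rfl⟩⟩
  | succ n ih =>
    intro v hv hrow
    by_cases hne : v = (x, 0)
    · subst hne
      exact ⟨SimpleGraph.Walk.nil, fun y hy => by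
        rw [SimpleGraph.Walk.support_nil, List.mem_singleton] at hy; subst hy; exact ⟨hrow, le_rfl⟩⟩
    obtain ⟨v', hadj, hrow', hlt⟩ := exists_adj_energy_lt x v hrow hne
    obtain ⟨w', hw'⟩ := ih v' (by push_cast at hv ⊢; omega) hrow'
    refine ⟨SimpleGraph.Walk.cons hadj w', fun y hy => ?_⟩
    rw [SimpleGraph.Walk.support_cons, List.mem_cons] at hy
    rcases hy with rfl | hy
    · exact ⟨hrow, le_rfl⟩
    · exact ⟨(hw' y hy).1, (hw' y hy).2.trans hlt.le⟩

/-- **The hypothesis `hlat` of the window lemmas in orientation `k = 0`.**  For the up-face root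
`q = (x, 0)` and any real `δ`, `ρ`: every vertex `v` on or beyond the row of `q` with
`δ c_v ∈ B(δ c_q, ρ)` is joined to `q` by a honeycomb walk all of whose vertices `y` satisfy
`δ c_y ∈ B(δ c_q, ρ)` and lie on or beyond the row of `q`. -/
theorem exists_walk_halfBall_rowZero {δ ρ : ℝ} (x : Site 2) {v : HexVertex}
    (hv : (δ : ℂ) * hexCenter v ∈ Metric.ball ((δ : ℂ) * hexCenter (x, 0)) ρ) (hrow : x 1 ≤ v.1 1) :
    ∃ w : hexGraph.Walk (x, 0) v, ∀ y ∈ w.support,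
      (δ : ℂ) * hexCenter y ∈ Metric.ball ((δ : ℂ) * hexCenter (x, 0)) ρ ∧ x 1 ≤ y.1 1 := by
  obtain ⟨w, hw⟩ := exists_walk_energy_le x (halfBallEnergy x v).toNat v
    (by rw [Int.toNat_of_nonneg (halfBallEnergy_nonneg x v)]) hrow
  refine ⟨w.reverse, fun y hy => ?_⟩
  rw [SimpleGraph.Walk.support_reverse, List.mem_reverse] at hy
  obtain ⟨hyrow, hyE⟩ := hw y hy
  refine ⟨?_, hyrow⟩
  rw [Metric.mem_ball] at hv ⊢
  have hle : dist (hexCenter y) (hexCenter (x, 0)) ≤ dist (hexCenter v) (hexCenter (x, 0)) := by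
    have h1 := twelve_mul_dist_sq_eq x y
    have h2 := twelve_mul_dist_sq_eq x v
    have hE : (halfBallEnergy x y : ℝ) ≤ halfBallEnergy x v := by exact_mod_cast hyE
    have hsq : dist (hexCenter y) (hexCenter (x, 0)) ^ 2 ≤ dist (hexCenter v) (hexCenter (x, 0)) ^ 2 := by
      linarith
    exact (pow_le_pow_iff_left₀ dist_nonneg dist_nonneg two_ne_zero).1 hsq
  have hmul : ∀ a b : ℂ, dist ((δ : ℂ) * a) ((δ : ℂ) * b) = ‖(δ : ℂ)‖ * dist a b := fun a b => by
    rw [Complex.dist_eq, Complex.dist_eq, ← mul_sub, norm_mul]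
  calc dist ((δ : ℂ) * hexCenter y) ((δ : ℂ) * hexCenter (x, 0))
      = ‖(δ : ℂ)‖ * dist (hexCenter y) (hexCenter (x, 0)) := hmul _ _
    _ ≤ ‖(δ : ℂ)‖ * dist (hexCenter v) (hexCenter (x, 0)) :=
        mul_le_mul_of_nonneg_left hle (norm_nonneg _)
    _ = dist ((δ : ℂ) * hexCenter v) ((δ : ℂ) * hexCenter (x, 0)) := (hmul _ _).symm
    _ < ρ := hv

/-! ### In orientation `0` the new root is an up-face above a vertical gate -/

/-- **In orientation `k = 0` the new root is an up-face and the gate is the vertical edge below it**: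
if `q = (x, 0)` and a neighbour `p` satisfy `rowOf 0 q = rowOf 0 p + 1` (`rowOf 0 v = v.1 1`), then
`p = (x - e₁, 1)`. -/
theorem gate_rowZero_eq (x : Site 2) {p : HexVertex} (hadj : hexGraph.Adj (x, 0) p)
    (h : x 1 = p.1 1 + 1) : p = (x - Pi.single 1 1, 1) := by
  obtain ⟨y, t⟩ := p
  simp only at h
  fin_cases t
  · exact absurd hadj
      (Literature.Probability.LatticeModels.not_hexGraph_adj_of_snd_eq_holds _ _ rfl)
  · rcases (hexGraph_adj_iff_of_snd_eq_zero_holds x y).1 hadj with rfl | rfl | rfl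
    · simp at h
    · simp at h
    · rfl

/-- … and a down-face `(x, 1)` is never one row above a neighbour, so every gate of orientation
`0` has an up-face as its new root (the case covered by `exists_walk_halfBall_rowZero`). -/
theorem gate_rowZero_ne_down (x : Site 2) {p : HexVertex} (hadj : hexGraph.Adj (x, 1) p)
    (h : x 1 = p.1 1 + 1) : False := by
  obtain ⟨y, t⟩ := p
  simp only at h
  fin_cases t
  · rcases (hexGraph_adj_iff_of_snd_eq_one x y).1 hadj with rfl | rfl | rfl
    · simp at h
    · simp at h
    · simp at h; omega
  · exact absurd hadj
      (Literature.Probability.LatticeModels.not_hexGraph_adj_of_snd_eq_holds _ _ rfl)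

/-! ### Registered form -/

/-- **Registered sub-goal `stub_carvedToSLE_halfBallRowZero`** (crux item
stmt-CriticalPhenomena-14005, line `bridge-gate-renewal`, stub `stub_carvedToSLE`): honeycomb
half-balls above a zigzag row are connected — the hypothesis `hlat` of
`stub_carvedToSLE_windowClause` in orientation `k = 0`, in registry form
(see `exists_walk_halfBall_rowZero`). -/
theorem stub_carvedToSLE_halfBallRowZero :
    ∀ (δ ρ : ℝ) (x : Site 2) (v : HexVertex),
      (δ : ℂ) * hexCenter v ∈ Metric.ball ((δ : ℂ) * hexCenter (x, 0)) ρ → x 1 ≤ v.1 1 →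
      ∃ w : hexGraph.Walk (x, 0) v, ∀ y ∈ w.support,
        (δ : ℂ) * hexCenter y ∈ Metric.ball ((δ : ℂ) * hexCenter (x, 0)) ρ ∧ x 1 ≤ y.1 1 :=
  fun _ _ x _ hv hrow => exists_walk_halfBall_rowZero x hv hrow

end Summit.CriticalPhenomena.SAWScalingLimit.Theorems.ObservableToSLER.BridgeGate

end
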